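import Literature.Analysis.FunctionSpaces.BesselIGeneratingFunction
import Mathlib.Analysis.SpecialFunctions.Trigonometric.Chebyshev.RootsExtrema
import Mathlib.Analysis.SpecialFunctions.Trigonometric.Inverse
import HarnessLib

/-!
# Venture YMGap, track Y3 FLOW-DATA — the Chebyshev–Bessel expansion `e^{xs} = Σ_{m∈ℤ} I_{|m|}(x) T_m(s)` on `[−1, 1]`
# and its truncation tail (lineage C «x2r» certificate, step R1)

HONEST FRAMING: venture file of the cell `pub-ymgap` (QuantumFields programme), track Y3, lineage C (engine-3; kernel «x2r»,
method note `engine/sce/results-Y3/onesite2/code-x2r/X2R-METHOD.md`, bookkeeping `engine/sce/CERT-CHAIN-C.md` step R1).  Pure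
one-variable real analysis; NO lattice, NO transfer matrix, no number of record, nothing about limits or a mass gap.

The x2r kernel applies the UNTRUNCATED plaquette operator `P̂ = e^{−2βy}` (`y ∈ [0,1]`) as a degree-`K` Chebyshev expansion in
`s = 1 − 2y ∈ [−1, 1]`: `e^{−2βy} = e^{−β} e^{βs}`, `e^{βs} = Σ_{m ∈ ℤ} I_{|m|}(β) T_{|m|}(s) = I₀(β) + 2 Σ_{k≥1} I_k(β) T_k(s)`, and books
the dropped part `|m| > K` as the rigorous sup-norm tail `τ'_K = e^{−β}(e^{β} − Σ_{|m| ≤ K} I_{|m|}(β))` («tau_cheb» in `x2r_rows.json`;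
e.g. `4.6958e-25` at β = 128, K = 120).  This file types exactly that:

* `hasSum_besselI_natAbs_mul_chebyshevT` — for `|s| ≤ 1`: `HasSum (m : ℤ ↦ I_{|m|}(x) · T_m(s)) (e^{x s})`, from the tree's Fourier series
  `e^{x cos θ} = Σ_m I_{|m|}(x) cos(mθ)` (`Literature…BesselIGeneratingFunction.hasSum_besselI_natAbs_mul_cos`, DLMF 10.35.2) at `θ = arccos s`
  and Mathlib's `T_m(cos θ) = cos(mθ)`;
* ★ `abs_exp_mul_sub_chebTrunc_le` — for `x ≥ 0`, `|s| ≤ 1` and every `K`: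
  `|e^{x s} − Σ_{m = −K}^{K} I_{|m|}(x) T_m(s)| ≤ e^{x} − Σ_{m = −K}^{K} I_{|m|}(x)` (`|T_m| ≤ 1`, `I_n ≥ 0`, `Σ_{m∈ℤ} I_{|m|}(x) = e^{x}`);
* `chebTailMass_nonneg`, and the normalised form `abs_exp_neg_mul_sub_le` for the engine's `e^{−x} e^{x s}` (tail `1 − e^{−x} Σ_{|m|≤K} I_{|m|}(x)`).

The binary128 ROUNDING part of the x2r budget `e_g` remains engine arithmetic.  References: NIST DLMF §10.35 [cite: DLMF, 10.35.2];
J. C. Mason, D. C. Handscomb, *Chebyshev Polynomials* (2003) §5.3 (Chebyshev series of entire functions) — context only.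
-/

noncomputable section

open Finset Polynomial.Chebyshev
open scoped BigOperators
open Literature.Analysis.FunctionSpaces

namespace Summit.Ventures.YMGap.FlowData.ChebyshevBesselTail

/-- The degree-`K` Chebyshev–Bessel truncation `Σ_{m = −K}^{K} I_{|m|}(x) T_m(s)` (`= I₀(x) + 2Σ_{k=1}^{K} I_k(x) T_k(s)`). [cite: DLMF, 10.35.2] -/
def chebTrunc (x s : ℝ) (K : ℕ) : ℝ :=
  ∑ m ∈ Icc (-(K : ℤ)) K, besselI m.natAbs x * (T ℝ m).eval s

/-- The dropped Bessel mass `e^{x} − Σ_{m = −K}^{K} I_{|m|}(x)` (the engine's `tau_cheb` before the `e^{−x}` normalisation). [cite: DLMF, 10.35.5] -/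
def chebTailMass (x : ℝ) (K : ℕ) : ℝ :=
  Real.exp x - ∑ m ∈ Icc (-(K : ℤ)) K, besselI m.natAbs x

/-- ★ The Chebyshev–Bessel expansion on `[−1, 1]`: `e^{x s} = Σ_{m ∈ ℤ} I_{|m|}(x) T_m(s)` for `|s| ≤ 1`. [cite: DLMF, 10.35.2] -/
theorem hasSum_besselI_natAbs_mul_chebyshevT (x : ℝ) {s : ℝ} (hs : |s| ≤ 1) :
    HasSum (fun m : ℤ => besselI m.natAbs x * (T ℝ m).eval s) (Real.exp (x * s)) := by
  obtain ⟨hs1, hs2⟩ := abs_le.1 hs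
  have hcos : Real.cos (Real.arccos s) = s := Real.cos_arccos hs1 hs2
  have h := hasSum_besselI_natAbs_mul_cos x (Real.arccos s)
  rw [hcos] at h
  refine h.congr_fun fun m => ?_
  show besselI m.natAbs x * (T ℝ m).eval s = besselI m.natAbs x * Real.cos (m * Real.arccos s)
  rw [← T_real_cos, hcos]

/-- The tail of the expansion beyond `|m| ≤ K` sums to `e^{xs} − chebTrunc`. [cite: DLMF, 10.35.2] -/
theorem hasSum_compl_chebTrunc (x : ℝ) {s : ℝ} (hs : |s| ≤ 1) (K : ℕ) :
    HasSum (fun m : {m : ℤ // m ∉ Icc (-(K : ℤ)) K} => besselI m.1.natAbs x * (T ℝ m.1).eval s)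
      (Real.exp (x * s) - chebTrunc x s K) := by
  have h := hasSum_besselI_natAbs_mul_chebyshevT x hs
  refine (Finset.hasSum_compl_iff (Icc (-(K : ℤ)) K)
    (f := fun m : ℤ => besselI m.natAbs x * (T ℝ m).eval s)).2 ?_
  rwa [chebTrunc, sub_add_cancel]

/-- The dropped Bessel mass is the sum of `I_{|m|}(x)` over `|m| > K`. [cite: DLMF, 10.35.5] -/
theorem hasSum_compl_besselI_natAbs (x : ℝ) (K : ℕ) :
    HasSum (fun m : {m : ℤ // m ∉ Icc (-(K : ℤ)) K} => besselI m.1.natAbs x) (chebTailMass x K) := by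
  have h := hasSum_besselI_natAbs x
  refine (Finset.hasSum_compl_iff (Icc (-(K : ℤ)) K) (f := fun m : ℤ => besselI m.natAbs x)).2 ?_
  rwa [chebTailMass, sub_add_cancel]

/-- `chebTailMass x K ≥ 0` for `x ≥ 0`. [cite: DLMF, 10.35.5] -/
theorem chebTailMass_nonneg {x : ℝ} (hx : 0 ≤ x) (K : ℕ) : 0 ≤ chebTailMass x K :=
  (hasSum_compl_besselI_natAbs x K).nonneg fun _ => besselI_nonneg _ hx

/-- ★ **Truncation tail of the Chebyshev–Bessel expansion.**  For `x ≥ 0`, `|s| ≤ 1` and every `K`: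
`|e^{x s} − Σ_{m=−K}^{K} I_{|m|}(x) T_m(s)| ≤ e^{x} − Σ_{m=−K}^{K} I_{|m|}(x)` (uniformly in `s`; `|T_m(s)| ≤ 1`, `I_n(x) ≥ 0`).
This is the x2r kernel's `tau_cheb` (times `e^{−β}` in the engine's normalisation). [cite: DLMF, 10.35.2] -/
theorem abs_exp_mul_sub_chebTrunc_le {x : ℝ} (hx : 0 ≤ x) {s : ℝ} (hs : |s| ≤ 1) (K : ℕ) :
    |Real.exp (x * s) - chebTrunc x s K| ≤ chebTailMass x K := by
  have ht := hasSum_compl_chebTrunc x hs K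
  have hm := hasSum_compl_besselI_natAbs x K
  rw [← ht.tsum_eq, ← hm.tsum_eq, ← Real.norm_eq_abs]
  refine (norm_tsum_le_tsum_norm ht.summable.norm).trans ?_
  refine ht.summable.norm.tsum_le_tsum (fun m => ?_) hm.summable
  rw [Real.norm_eq_abs, abs_mul, abs_of_nonneg (besselI_nonneg _ hx)]
  exact mul_le_of_le_one_right (besselI_nonneg _ hx) (abs_eval_T_real_le_one _ hs)

/-- The same in the engine's normalisation `P̂`-symbol `e^{−x} e^{x s}` (`= e^{−2βy}` with `x = β`, `s = 1 − 2y`): the truncation error is at most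
`1 − e^{−x} Σ_{m=−K}^{K} I_{|m|}(x)` (the number `tau_cheb` of `x2r_rows.json`, up to the kernel's own rounding budget). [cite: DLMF, 10.35.2] -/
theorem abs_exp_neg_mul_sub_le {x : ℝ} (hx : 0 ≤ x) {s : ℝ} (hs : |s| ≤ 1) (K : ℕ) :
    |Real.exp (-x) * Real.exp (x * s) - Real.exp (-x) * chebTrunc x s K|
      ≤ 1 - Real.exp (-x) * ∑ m ∈ Icc (-(K : ℤ)) K, besselI m.natAbs x := by
  have hpos : 0 < Real.exp (-x) := Real.exp_pos _
  rw [← mul_sub, abs_mul, abs_of_pos hpos]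
  have h := mul_le_mul_of_nonneg_left (abs_exp_mul_sub_chebTrunc_le hx hs K) hpos.le
  refine h.trans (le_of_eq ?_)
  rw [chebTailMass, mul_sub, ← Real.exp_add, neg_add_cancel, Real.exp_zero]

/-- For `y ∈ [0, 1]` the variable `s = 1 − 2y` lies in `[−1, 1]` (the engine's substitution). [folklore] -/
theorem abs_one_sub_two_mul_le_one {y : ℝ} (hy0 : 0 ≤ y) (hy1 : y ≤ 1) : |1 - 2 * y| ≤ 1 :=
  abs_le.2 ⟨by linarith, by linarith⟩

end Summit.Ventures.YMGap.FlowData.ChebyshevBesselTail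

end
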